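import Literature.Geometry.Symplectic.SteinBallHandle
import Literature.Geometry.Symplectic.SteinBoundaryContact
import HarnessLib

/-!
# The handle framing of a 2-handle attaching map is a framing of its attaching circle (proofs)

Topic `Literature/Geometry/Symplectic`; a proofs-only file below `HandleAttachingMaps.lean`
(Kosinski's attaching maps `h̄ : T → W` of 4-dimensional 2-handles, with attaching circle
`h.attachingCircle = h̄|S¹ × 0 : 𝕊¹ → ∂W` and handle framing
`h.attachingFraming θ = dh̄_{(θ,0)}(Dι⁻¹ e₂)`, Kirby's `f(S¹ × e₁)`) and
`SteinBoundaryContact.lean` (`IsKnotFraming K ν`: a vector field along `K`, continuous into the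
tangent bundle `TW`, tangent to `∂W`, nowhere tangent to `K` — the notion on which the twisting
number `SteinStructure.twisting`, the stabilisation fact `Gompf1998_addLeftTwists`, the
homotopies `FramingHomotopic` and the facts ISO/TUBE of `TwoHandleIsotopy.lean` are phrased).
**Main theorem, proved for every attaching map on every smooth 4-manifold with boundary:**

* `isKnotFraming_attachingFraming (h : HandleAttachingMap 3 2 W) :
    IsKnotFraming h.attachingCircle h.attachingFraming`.

So the handle framing may be fed, as it stands, to `Gompf1998_addLeftTwists`,
`FramingHomotopic.refl`, … — one of the two tacit obligations ("handle framings are knot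
framings", "attaching circles are embeddings") on the way from Eliashberg's theorem
(`Gompf1998_thm13_twoHandles`) to Akbulut–Matveyev's defect-zero criterion
(`AkbulutMatveyev1998_defectZero`) noted in `AkbulutMatveyev.lean`; the other needs the
inverse function theorem for manifolds with boundary and stays open.

## The three clauses

* **nowhere tangent** (`attachingFraming_not_mem_span`): the velocity of the attaching circle is
  `dh̄` of the velocity of the model circle (`knotVelocity_attachingCircle`, chain rule; the model
  circle `coreTubePt` is smooth into `T`, `contMDiff_coreTubePt`), `dh̄` is injective (`h̄` is an
  immersion, `injective_mfderiv_handleAttachingMap`), and below in `T`, read ambiently through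
  `Dι = closedBallCoeDeriv` (`hasMFDerivAt_restrict_opens`), the two vectors are `e₂` and
  `2π(-sin, cos, 0, 0)` (`closedBallCoeDeriv_mfderiv_coreTubePt_circlePt`);
* **tangent to `∂W`** (`attachingFraming_apply_zero`): in extended charts `h̄` reads
  `G : {x₀ ≥ 0} → {y₀ ≥ 0}` near the base point, and `G({x₀ = 0}) ⊆ {y₀ = 0}` there — boundary
  points of `T` are the points of norm `1` (the chart of the open submanifold `T` is the
  restricted polar chart of `D⁴`, `0`-th coordinate `1 - ‖x‖`,
  `extChartAt_coreTubePt_apply_zero`), `h̄` maps them to `∂W` (`HandleAttachingMap.isBoundaryPoint`),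
  and boundary points of `W` have vanishing `0`-th coordinate in *any* chart of the atlas
  (Mathlib's `ModelWithCorners.isBoundaryPoint_iff_of_mem_atlas`, smooth invariance of the
  boundary; `extChartAt_attachingMap_apply_zero_of_norm_eq_one`).  Hence `G₀` has derivative
  both `π₀ ∘ dG` and `0` within the hyperplane `{x₀ = 0}`, whose tangent cone contains the
  framing direction `w = Dι⁻¹e₂` (`w₀ = 0`; `mem_tangentConeAt_hyperplane`), and derivatives are
  unique on the tangent cone (`HasFDerivWithinAt.unique_on`): `(dG w)₀ = 0`;
* **continuous into `TW`** (`continuous_coreSection` + `ContMDiff.continuous_tangentMap`): the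
  map `u ↦ (K u, ν u)` is `tangentMap h̄ ∘ (u ↦ ((u,0), Dι⁻¹e₂))`; the second factor is continuous
  into `TT` by the fibre-bundle criterion (`FiberBundle.continuousAt_totalSpace`): in the
  trivialisation of `TT` at a circle point its fibre coordinate is, near that point, the ambient
  expression `D(ambChart)(θ, 0) e₂` of `ClosedBallTangent.lean`
  (`trivializationAt_coreSection_snd_eventuallyEq`, using that the transition maps of the charts
  of the open submanifold `T` are those of `D⁴` near the base point,
  `extend_comp_symm_eventuallyEq_tube`), which is continuous
  (`contMDiffAt_fderiv_closedBallAmbChart`).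

## References

* R. C. Kirby, *The Topology of 4-Manifolds* (1989), Ch. I §2 (the framing `f(S¹ × e₁)`).
  [Kirby1989]
* A. A. Kosinski, *Differential Manifolds* (1993), VI §6. [Kosinski1993]
* J. M. Lee, *Introduction to Smooth Manifolds* (2013), Prop. 3.9, Thm. 5.11 (open submanifolds;
  the boundary is well defined).

No declaration in this file uses `sorry`; there are no named facts.
-/

noncomputable section

open scoped Manifold ContDiff Topology RealInnerProductSpace
open Set Function Metric

namespace Literature.Geometry.Symplectic

open Literature.Topology.FourManifolds

/-- The model vector space `ℝ⁴` of the tangent spaces. [folklore] -/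
local notation "E4" => EuclideanSpace ℝ (Fin 4)
/-- The plane `ℝ²`. [folklore] -/
local notation "E2" => EuclideanSpace ℝ (Fin 2)
/-- The closed unit 4-ball. [folklore] -/
local notation "𝔻⁴" => (Metric.closedBall (0 : EuclideanSpace ℝ (Fin 4)) 1)
/-- Local notation: `𝕊 n` is the unit sphere in `EuclideanSpace ℝ (Fin (n + 1))`. -/
local notation "𝕊 " n:arg => (Metric.sphere (0 : EuclideanSpace ℝ (Fin (n + 1))) 1)

attribute [local instance] fact_finrank_euclideanSpace_succ

/-! ### The model circle `S¹ × 0 ⊆ T`: smoothness and velocity -/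

/-- The plane `ℝ²_λ ↪ ℝ⁴`, `(a, b) ↦ (a, b, 0, 0)`, as a linear map. [folklore] -/
def lamPlaneLin : E2 →ₗ[ℝ] E4 where
  toFun u := WithLp.toLp 2 ![u 0, u 1, 0, 0]
  map_add' u v := by ext i; fin_cases i <;> simp
  map_smul' c u := by ext i; fin_cases i <;> simp

/-- `corePt θ = lamPlaneLin θ`. [folklore] -/
theorem corePt_eq_lamPlaneLin (θ : 𝕊 1) : corePt θ = lamPlaneLin (θ : E2) := by
  ext i; fin_cases i <;> rfl

/-- The model circle `θ ↦ (θ, 0)` is smooth as a map into the closed ball. [folklore] -/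
theorem contMDiff_coe_coreTubePt :
    ContMDiff (𝓡 1) (𝓡∂ 4) ∞ (fun θ : 𝕊 1 => ((coreTubePt θ : ↥(handleTube 3 2)) : 𝔻⁴)) := by
  have h1 : ContMDiff (𝓡 1) 𝓘(ℝ, E4) ∞ (fun θ : 𝕊 1 => lamPlaneLin (θ : E2)) :=
    (lamPlaneLin.toContinuousLinearMap.contDiff.contMDiff).comp contMDiff_coe_sphere
  have h2 : ContMDiff (𝓡 1) 𝓘(ℝ, E4) ∞ (fun θ : 𝕊 1 => corePt θ) := by
    refine h1.congr fun θ => ?_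
    exact corePt_eq_lamPlaneLin θ
  exact ContMDiff.codRestrict_closedBall h2 _

/-- … and as a map into Kosinski's tube `T`. [folklore] -/
theorem contMDiff_coreTubePt : ContMDiff (𝓡 1) (𝓡∂ 4) ∞ (coreTubePt : 𝕊 1 → ↥(handleTube 3 2)) :=
  (ContMDiff.subtypeVal_comp_iff (handleTube 3 2) coreTubePt).1 contMDiff_coe_coreTubePt

/-- The ambient velocity `2π(-sin 2πt, cos 2πt, 0, 0)` of the model circle. [folklore] -/
def coreVelocityAmb (t : ℝ) : E4 :=
  lamPlaneLin ((-(2 * Real.pi * Real.sin (2 * Real.pi * t))) • EuclideanSpace.single (0 : Fin 2) (1 : ℝ) +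
    (2 * Real.pi * Real.cos (2 * Real.pi * t)) • EuclideanSpace.single (1 : Fin 2) (1 : ℝ))

/-- Coordinate `2` of the model velocity vanishes. [folklore] -/
@[simp] theorem coreVelocityAmb_apply_two (t : ℝ) : coreVelocityAmb t 2 = 0 := by
  simp [coreVelocityAmb, lamPlaneLin]

/-- The ambient model circle `t ↦ corePt (circlePt t)` and its velocity. [folklore] -/
theorem hasDerivAt_corePt_circlePt (t : ℝ) :
    HasDerivAt (fun s : ℝ => corePt (circlePt s)) (coreVelocityAmb t) t := by
  have h : (fun s : ℝ => corePt (circlePt s)) = fun s => lamPlaneLin ((circlePt s : 𝕊 1) : E2) :=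
    funext fun s => corePt_eq_lamPlaneLin _
  rw [h]
  exact lamPlaneLin.toContinuousLinearMap.hasFDerivAt.comp_hasDerivAt t (hasDerivAt_coe_circlePt t)

/-- **The velocity of the model circle in `T`, read ambiently**:
`Dι (d/dt (θ(t), 0)) = 2π(-sin, cos, 0, 0)`. [folklore] -/
theorem closedBallCoeDeriv_mfderiv_coreTubePt_circlePt (t : ℝ) :
    closedBallCoeDeriv ((coreTubePt (circlePt t) : ↥(handleTube 3 2)) : 𝔻⁴)
        (mfderiv 𝓘(ℝ, ℝ) (𝓡∂ 4) (coreTubePt ∘ circlePt) t (1 : ℝ)) = coreVelocityAmb t := by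
  have hc : MDifferentiableAt 𝓘(ℝ, ℝ) (𝓡∂ 4) (coreTubePt ∘ circlePt) t :=
    ((contMDiff_coreTubePt _).comp t contMDiff_circlePt.contMDiffAt).mdifferentiableAt (by simp)
  -- the composite with the coordinate map `T → ℝ⁴`
  have hval : HasMFDerivAt (𝓡∂ 4) 𝓘(ℝ, E4) (fun y : ↥(handleTube 3 2) => ((y : 𝔻⁴) : E4))
      (coreTubePt (circlePt t))
      (closedBallCoeDeriv ((coreTubePt (circlePt t) : ↥(handleTube 3 2)) : 𝔻⁴) : E4 →L[ℝ] E4) :=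
    hasMFDerivAt_restrict_opens (handleTube 3 2) (hasMFDerivAt_coe_closedBall _)
  have h2 := hval.comp t hc.hasMFDerivAt
  have h1 : HasMFDerivAt 𝓘(ℝ, ℝ) 𝓘(ℝ, E4)
      ((fun y : ↥(handleTube 3 2) => ((y : 𝔻⁴) : E4)) ∘ (coreTubePt ∘ circlePt)) t
      (ContinuousLinearMap.smulRight (1 : ℝ →L[ℝ] ℝ) (coreVelocityAmb t)) :=
    (hasDerivAt_corePt_circlePt t).hasFDerivAt.hasMFDerivAt
  have h3 : (((closedBallCoeDeriv ((coreTubePt (circlePt t) : ↥(handleTube 3 2)) : 𝔻⁴) : E4 →L[ℝ] E4).comp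
      (mfderiv 𝓘(ℝ, ℝ) (𝓡∂ 4) (coreTubePt ∘ circlePt) t)) : ℝ →L[ℝ] E4) =
      ContinuousLinearMap.smulRight (1 : ℝ →L[ℝ] ℝ) (coreVelocityAmb t) :=
    h2.mfderiv.symm.trans h1.mfderiv
  have h4 := ContinuousLinearMap.ext_iff.1 h3 (1 : ℝ)
  rw [ContinuousLinearMap.comp_apply, ContinuousLinearMap.smulRight_apply] at h4
  have h5 : ((1 : ℝ →L[ℝ] ℝ) (1 : ℝ) : ℝ) • coreVelocityAmb t = coreVelocityAmb t := by simp
  exact h4.trans h5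

variable {W : Type*} [TopologicalSpace W] [ChartedSpace (EuclideanHalfSpace 4) W] [IsManifold (𝓡∂ 4) ∞ W]

omit [IsManifold (𝓡∂ 4) ∞ W] in
/-- The attaching circle is the attaching map along the model circle (as functions). [folklore] -/
theorem attachingCircle_comp_circlePt (h : HandleAttachingMap 3 2 W) :
    h.attachingCircle ∘ circlePt = h.toFun ∘ (coreTubePt ∘ circlePt) := rfl

omit [IsManifold (𝓡∂ 4) ∞ W] in
/-- The attaching map is differentiable. [folklore] -/
theorem mdifferentiableAt_handleAttachingMap (h : HandleAttachingMap 3 2 W) (y : ↥(handleTube 3 2)) :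
    MDifferentiableAt (𝓡∂ 4) (𝓡∂ 4) h.toFun y :=
  (h.isSmoothEmbedding.contMDiff y).mdifferentiableAt (by simp)

omit [IsManifold (𝓡∂ 4) ∞ W] in
/-- **The velocity of the attaching circle is the push-forward of the model velocity**:
`ċ(t) = dh̄ (d/dt (θ(t), 0))`. [folklore] -/
theorem knotVelocity_attachingCircle (h : HandleAttachingMap 3 2 W) (t : ℝ) :
    knotVelocity h.attachingCircle t =
      mfderiv (𝓡∂ 4) (𝓡∂ 4) h.toFun (coreTubePt (circlePt t))
        (mfderiv 𝓘(ℝ, ℝ) (𝓡∂ 4) (coreTubePt ∘ circlePt) t (1 : ℝ)) := by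
  have hc : MDifferentiableAt 𝓘(ℝ, ℝ) (𝓡∂ 4) (coreTubePt ∘ circlePt) t :=
    ((contMDiff_coreTubePt _).comp t contMDiff_circlePt.contMDiffAt).mdifferentiableAt (by simp)
  unfold knotVelocity
  rw [attachingCircle_comp_circlePt, mfderiv_comp t (mdifferentiableAt_handleAttachingMap h _) hc]
  rfl

/-- The differential of an attaching map is injective. [folklore] -/
theorem injective_mfderiv_handleAttachingMap (h : HandleAttachingMap 3 2 W) (y : ↥(handleTube 3 2)) :
    Injective (mfderiv (𝓡∂ 4) (𝓡∂ 4) h.toFun y) := by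
  obtain ⟨F, _, _, hF⟩ := h.isSmoothEmbedding.isImmersion
  exact Manifold.IsImmersionAtOfComplement.mfderiv_injective (hF y) (by simp)

/-- **The handle framing is nowhere tangent to the attaching circle**: `ν(θ(t)) ∉ ℝ ċ(t)`
(push both down to `T` by the injective `dh̄`, then to `ℝ⁴` by `Dι`: `e₂` versus
`2π(-sin, cos, 0, 0)`). [folklore] -/
theorem attachingFraming_not_mem_span (h : HandleAttachingMap 3 2 W) (t : ℝ) :
    h.attachingFraming (circlePt t) ∉ (ℝ ∙ knotVelocity h.attachingCircle t : Submodule ℝ E4) := by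
  rw [Submodule.mem_span_singleton, knotVelocity_attachingCircle]
  rintro ⟨a, ha⟩
  set L : E4 →L[ℝ] E4 := mfderiv (𝓡∂ 4) (𝓡∂ 4) h.toFun (coreTubePt (circlePt t)) with hL
  set v : E4 := mfderiv 𝓘(ℝ, ℝ) (𝓡∂ 4) (coreTubePt ∘ circlePt) t (1 : ℝ) with hv
  set w : E4 := (closedBallCoeDeriv ((coreTubePt (circlePt t) : ↥(handleTube 3 2)) : 𝔻⁴)).symm
    (EuclideanSpace.single (2 : Fin 4) (1 : ℝ)) with hw
  change a • L v = L w at ha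
  have ha' : L (a • v) = L w := by rw [L.map_smul]; exact ha
  have heq : a • v = w := injective_mfderiv_handleAttachingMap h _ ha'
  have h2 := congrArg (fun u : E4 =>
    closedBallCoeDeriv ((coreTubePt (circlePt t) : ↥(handleTube 3 2)) : 𝔻⁴) u 2) heq
  simp only at h2
  rw [map_smul, hv, closedBallCoeDeriv_mfderiv_coreTubePt_circlePt, hw,
    ContinuousLinearEquiv.apply_symm_apply, PiLp.smul_apply, coreVelocityAmb_apply_two,
    smul_eq_mul, mul_zero] at h2
  simp at h2

/-! ### The handle framing is tangent to `∂W` -/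

/-- Directions in the hyperplane `{x₀ = 0}` lie in its tangent cone at any of its points.
[folklore] -/
theorem mem_tangentConeAt_hyperplane {p w : E4} (hp : p 0 = 0) (hw : w 0 = 0) :
    w ∈ tangentConeAt ℝ {q : E4 | q 0 = 0} p := by
  have hseg : segment ℝ p (p + w) ⊆ {q : E4 | q 0 = 0} := by
    refine (convex_iff_segment_subset.1 ?_) (by exact hp) ?_
    · intro a ha b hb s t _ _ _
      have ha0 : a 0 = 0 := ha
      have hb0 : b 0 = 0 := hb
      show (s • a + t • b) 0 = 0
      simp [ha0, hb0]
    · show (p + w) 0 = 0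
      simp [hp, hw]
  have := mem_tangentConeAt_of_segment_subset hseg
  rwa [add_sub_cancel_left] at this

/-- A point of `T` is a boundary point iff its `0`-th coordinate in the (extended) chart of `T`
at a point `pt` of the model circle vanishes (that chart is the restriction of the polar boundary
chart of `D⁴`, whose `0`-th coordinate is `1 - ‖x‖`). [folklore] -/
theorem extChartAt_coreTubePt_apply_zero (θ : 𝕊 1) (y : ↥(handleTube 3 2)) :
    (extChartAt (𝓡∂ 4) (coreTubePt θ) y) 0 = 1 - ‖((y : 𝔻⁴) : E4)‖ := by
  have h1 : ‖(((coreTubePt θ : ↥(handleTube 3 2)) : 𝔻⁴) : E4)‖ = 1 := by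
    rw [coe_coe_coreTubePt]; exact norm_corePt θ
  rw [extChartAt, TopologicalSpace.Opens.chartAt_eq, OpenPartialHomeomorph.extend_coe, comp_apply,
    OpenPartialHomeomorph.subtypeRestr_coe, restrict_apply]
  show ((chartAt (EuclideanHalfSpace 4) ((coreTubePt θ : ↥(handleTube 3 2)) : 𝔻⁴)).extend (𝓡∂ 4)
    (y : 𝔻⁴)) 0 = _
  rw [closedBall_chartAt_of_norm_eq_one h1, closedBallBoundaryChart_extend_apply_zero]

/-- The base point of that chart has `0`-th coordinate `0`. [folklore] -/
theorem extChartAt_coreTubePt_self_apply_zero (θ : 𝕊 1) :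
    (extChartAt (𝓡∂ 4) (coreTubePt θ) (coreTubePt θ)) 0 = 0 := by
  rw [extChartAt_coreTubePt_apply_zero, coe_coe_coreTubePt, norm_corePt, sub_self]

/-- The framing direction `Dι⁻¹ e₂` at a point of the model circle is tangent to `∂D⁴`: its `0`-th
chart coordinate vanishes. [folklore] -/
theorem closedBallCoeDeriv_symm_single_two_apply_zero (θ : 𝕊 1) :
    ((closedBallCoeDeriv ((coreTubePt θ : ↥(handleTube 3 2)) : 𝔻⁴)).symm
      (EuclideanSpace.single (2 : Fin 4) (1 : ℝ))) 0 = 0 := by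
  have h1 : ‖(((coreTubePt θ : ↥(handleTube 3 2)) : 𝔻⁴) : E4)‖ = 1 := by
    rw [coe_coe_coreTubePt]; exact norm_corePt θ
  rw [apply_zero_eq_neg_inner_closedBallCoeDeriv h1, ContinuousLinearEquiv.apply_symm_apply,
    coe_coe_coreTubePt, inner_fin_four]
  simp

/-- **An attaching map sends boundary points of `T` near the model circle to points whose `0`-th
coordinate vanishes in the chart of `W` at the image of the circle point** (boundary points of
`W`, read in a chart of the atlas: Mathlib's `isBoundaryPoint_iff_of_mem_atlas`). [folklore] -/
theorem extChartAt_attachingMap_apply_zero_of_norm_eq_one (h : HandleAttachingMap 3 2 W) (θ : 𝕊 1)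
    {y : ↥(handleTube 3 2)} (hy : ‖((y : 𝔻⁴) : E4)‖ = 1)
    (hys : h.toFun y ∈ (chartAt (EuclideanHalfSpace 4) (h.toFun (coreTubePt θ))).source) :
    (extChartAt (𝓡∂ 4) (h.toFun (coreTubePt θ)) (h.toFun y)) 0 = 0 := by
  have hb : (𝓡∂ 4).IsBoundaryPoint (h.toFun y) := h.isBoundaryPoint y hy
  rw [(𝓡∂ 4).isBoundaryPoint_iff_of_mem_atlas (n := ∞) (by simp) (chart_mem_atlas _ _) hys] at hb
  -- `hb`: the chart point lies on the frontier of the chart target, hence not in the interior of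
  -- the half-space, i.e. its `0`-th coordinate vanishes
  set e := chartAt (EuclideanHalfSpace 4) (h.toFun (coreTubePt θ)) with he
  have hmem : e.extend (𝓡∂ 4) (h.toFun y) ∈ (e.extend (𝓡∂ 4)).target :=
    (e.extend (𝓡∂ 4)).map_source (by rwa [OpenPartialHomeomorph.extend_source])
  have hnot : e.extend (𝓡∂ 4) (h.toFun y) ∉ interior (e.extend (𝓡∂ 4)).target := fun hi =>
    hb.2 hi
  have hnot' : e.extend (𝓡∂ 4) (h.toFun y) ∉ interior (range (𝓡∂ 4)) := by
    intro hi
    apply hnot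
    have hyt : e (h.toFun y) ∈ e.target := e.map_source hys
    have := e.mem_interior_extend_target (I := 𝓡∂ 4) hyt (by
      rw [OpenPartialHomeomorph.extend_coe, comp_apply] at hi; exact hi)
    rw [OpenPartialHomeomorph.extend_coe, comp_apply]
    exact this
  rw [interior_range_modelWithCornersEuclideanHalfSpace] at hnot'
  have hge : 0 ≤ (e.extend (𝓡∂ 4) (h.toFun y)) 0 := by
    have : e.extend (𝓡∂ 4) (h.toFun y) ∈ range (𝓡∂ 4) := mem_range_self _
    rw [range_modelWithCornersEuclideanHalfSpace] at this
    exact this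
  simp only [mem_setOf_eq, not_lt] at hnot'
  show (e.extend (𝓡∂ 4) (h.toFun y)) 0 = 0
  exact le_antisymm hnot' hge

/-- **The handle framing is tangent to `∂W`**: its `0`-th coordinate in the preferred chart at
the point of the attaching circle vanishes.  In the extended charts the attaching map reads
`G : {x₀ ≥ 0} → {y₀ ≥ 0}` with `G({x₀ = 0}) ⊆ {y₀ = 0}` near the base point, so the derivative
within the half-space maps the hyperplane direction `w = Dι⁻¹e₂` (`w₀ = 0`) into `{v₀ = 0}`
(uniqueness of derivatives along the tangent cone of the hyperplane). [folklore] -/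
theorem attachingFraming_apply_zero (h : HandleAttachingMap 3 2 W) (θ : 𝕊 1) :
    h.attachingFraming θ 0 = 0 := by
  set pt : ↥(handleTube 3 2) := coreTubePt θ with hpt
  set w : E4 := (closedBallCoeDeriv ((coreTubePt θ : ↥(handleTube 3 2)) : 𝔻⁴)).symm
    (EuclideanSpace.single (2 : Fin 4) (1 : ℝ)) with hw
  have hw0 : w 0 = 0 := closedBallCoeDeriv_symm_single_two_apply_zero θ
  -- the written-in-charts map and its derivative within the half-space
  set G : E4 → E4 := writtenInExtChartAt (𝓡∂ 4) (𝓡∂ 4) pt h.toFun with hG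
  set L : E4 →L[ℝ] E4 := mfderiv (𝓡∂ 4) (𝓡∂ 4) h.toFun pt with hL
  set p : E4 := extChartAt (𝓡∂ 4) pt pt with hp
  have hp0 : p 0 = 0 := extChartAt_coreTubePt_self_apply_zero θ
  have hd : HasMFDerivAt (𝓡∂ 4) (𝓡∂ 4) h.toFun pt (mfderiv (𝓡∂ 4) (𝓡∂ 4) h.toFun pt) :=
    (mdifferentiableAt_handleAttachingMap h pt).hasMFDerivAt
  have hGd : HasFDerivWithinAt G L (range (𝓡∂ 4)) p := hd.2
  -- the `0`-th component
  set π₀ : E4 →L[ℝ] ℝ := EuclideanSpace.proj (0 : Fin 4) with hπ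
  have hG0d : HasFDerivWithinAt (fun q : E4 => π₀ (G q)) (π₀.comp L) (range (𝓡∂ 4)) p :=
    π₀.hasFDerivAt.comp_hasFDerivWithinAt p hGd
  -- the hyperplane `S = {q | q 0 = 0}` through `p`, inside the half-space
  set S : Set E4 := {q | q 0 = 0} with hS
  have hSsub : S ⊆ range (𝓡∂ 4) := fun q hq => by
    rw [range_modelWithCornersEuclideanHalfSpace]; exact le_of_eq (Eq.symm hq)
  have hG0S : HasFDerivWithinAt (fun q : E4 => π₀ (G q)) (π₀.comp L) S p := hG0d.mono hSsub
  -- `G₀` vanishes on `S` near `p`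
  have hzero : ∀ᶠ q in 𝓝[S] p, π₀ (G q) = 0 := by
    -- points of the chart target whose preimage maps into the chart source of `W`
    have hn1 : ∀ᶠ q in 𝓝[range (𝓡∂ 4)] p, q ∈ (extChartAt (𝓡∂ 4) pt).target :=
      extChartAt_target_mem_nhdsWithin pt
    have hn2 : ∀ᶠ q in 𝓝[range (𝓡∂ 4)] p,
        h.toFun ((extChartAt (𝓡∂ 4) pt).symm q) ∈ (chartAt (EuclideanHalfSpace 4) (h.toFun pt)).source := by
      have hc : ContinuousWithinAt (h.toFun ∘ (extChartAt (𝓡∂ 4) pt).symm) (range (𝓡∂ 4)) p := by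
        refine (h.continuous.continuousAt).comp_continuousWithinAt ?_
        rw [hp]; exact (continuousAt_extChartAt_symm pt).continuousWithinAt
      have ho : (chartAt (EuclideanHalfSpace 4) (h.toFun pt)).source ∈ 𝓝 ((h.toFun ∘ (extChartAt (𝓡∂ 4) pt).symm) p) := by
        rw [comp_apply, hp, extChartAt_to_inv]
        exact (chartAt _ _).open_source.mem_nhds (mem_chart_source _ _)
      exact hc.preimage_mem_nhdsWithin ho
    have hn : ∀ᶠ q in 𝓝[S] p, q ∈ (extChartAt (𝓡∂ 4) pt).target ∧
        h.toFun ((extChartAt (𝓡∂ 4) pt).symm q) ∈ (chartAt (EuclideanHalfSpace 4) (h.toFun pt)).source :=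
      nhdsWithin_mono p hSsub (hn1.and hn2)
    filter_upwards [hn, self_mem_nhdsWithin] with q hq hqS
    set y : ↥(handleTube 3 2) := (extChartAt (𝓡∂ 4) pt).symm q with hy
    have hqy : extChartAt (𝓡∂ 4) pt y = q := (extChartAt (𝓡∂ 4) pt).right_inv hq.1
    have hy1 : ‖((y : 𝔻⁴) : E4)‖ = 1 := by
      have := extChartAt_coreTubePt_apply_zero θ y
      rw [← hpt, hqy] at this
      have hq0 : q 0 = 0 := hqS
      linarith
    have := extChartAt_attachingMap_apply_zero_of_norm_eq_one h θ hy1 hq.2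
    simp only [hG, writtenInExtChartAt, comp_apply, hπ]
    exact this
  have hG0p : π₀ (G p) = 0 := by
    have hy1 : ‖(((pt : ↥(handleTube 3 2)) : 𝔻⁴) : E4)‖ = 1 := by
      rw [hpt, coe_coe_coreTubePt]; exact norm_corePt θ
    have := extChartAt_attachingMap_apply_zero_of_norm_eq_one h θ hy1 (by rw [hpt]; exact mem_chart_source _ _)
    simp only [hG, writtenInExtChartAt, comp_apply, hπ, hp, extChartAt_to_inv]
    exact this
  have hZ : HasFDerivWithinAt (fun q : E4 => π₀ (G q)) (0 : E4 →L[ℝ] ℝ) S p :=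
    (hasFDerivWithinAt_const (0 : ℝ) p S).congr_of_eventuallyEq hzero hG0p
  -- uniqueness on the tangent cone of `S` at `p`, which contains `w`
  have hcone : w ∈ tangentConeAt ℝ S p := mem_tangentConeAt_hyperplane hp0 hw0
  have huniq := hG0S.unique_on hZ hcone
  simp only [ContinuousLinearMap.comp_apply, hπ] at huniq
  -- `huniq : (L w) 0 = 0`, and `L w` is the handle framing at `θ`
  exact huniq

/-! ### Continuity into the tangent bundle -/

/-- The framing direction field `y ↦ Dι_y⁻¹ e₂` on Kosinski's tube `T`. [folklore] -/
def tubeFramingField (y : ↥(handleTube 3 2)) : E4 :=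
  (closedBallCoeDeriv (y : 𝔻⁴)).symm (EuclideanSpace.single (2 : Fin 4) (1 : ℝ))

omit [IsManifold (𝓡∂ 4) ∞ W] in
/-- The handle framing is the push-forward of the framing direction field along the model circle
(definitional). [folklore] -/
theorem attachingFraming_eq (h : HandleAttachingMap 3 2 W) (θ : 𝕊 1) :
    h.attachingFraming θ =
      mfderiv (𝓡∂ 4) (𝓡∂ 4) h.toFun (coreTubePt θ) (tubeFramingField (coreTubePt θ)) := rfl

/-- **The transition maps of the charts of `T` are those of `D⁴` near the base point** (the
charts of the open submanifold `T` are the restricted charts). [folklore] -/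
theorem extend_comp_symm_eventuallyEq_tube (y₀ y : ↥(handleTube 3 2)) :
    ((chartAt (EuclideanHalfSpace 4) y₀).extend (𝓡∂ 4) ∘
        ((chartAt (EuclideanHalfSpace 4) y).extend (𝓡∂ 4)).symm) =ᶠ[𝓝
      ((chartAt (EuclideanHalfSpace 4) y).extend (𝓡∂ 4) y)]
      ((chartAt (EuclideanHalfSpace 4) (y₀ : 𝔻⁴)).extend (𝓡∂ 4) ∘
        ((chartAt (EuclideanHalfSpace 4) (y : 𝔻⁴)).extend (𝓡∂ 4)).symm) := by
  have h1 := TopologicalSpace.Opens.chartAt_subtype_val_symm_eventuallyEq (H := EuclideanHalfSpace 4)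
    (handleTube 3 2) (x := y)
  have h2 : ContinuousAt (𝓡∂ 4).symm ((chartAt (EuclideanHalfSpace 4) y).extend (𝓡∂ 4) y) :=
    (𝓡∂ 4).continuous_symm.continuousAt
  have h3 : (𝓡∂ 4).symm ((chartAt (EuclideanHalfSpace 4) y).extend (𝓡∂ 4) y) =
      chartAt (EuclideanHalfSpace 4) (y : 𝔻⁴) (y : 𝔻⁴) := by
    simp only [OpenPartialHomeomorph.extend_coe, Function.comp_apply, ModelWithCorners.left_inv]
    rfl
  rw [ContinuousAt, h3] at h2
  filter_upwards [h2.eventually h1] with z hz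
  simp only [Function.comp_apply, TopologicalSpace.Opens.chartAt_eq] at hz
  simp only [comp_apply, OpenPartialHomeomorph.extend_coe_symm, OpenPartialHomeomorph.extend_coe,
    TopologicalSpace.Opens.chartAt_eq, OpenPartialHomeomorph.subtypeRestr_coe, restrict_apply]
  rw [hz]

/-- **The fibre coordinate of the framing direction field along the model circle, in the
trivialisation of `TT` at a circle point, in ambient terms** (valid near the base point):
`D(ambChart (θ₀,0))(θ, 0) e₂`. [folklore] -/
theorem trivializationAt_coreSection_snd_eventuallyEq (u₀ : 𝕊 1) :
    (fun u : 𝕊 1 => ((trivializationAt E4 (TangentSpace (𝓡∂ 4)) (coreTubePt u₀))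
        (Bundle.TotalSpace.mk' E4 (coreTubePt u) (tubeFramingField (coreTubePt u)) :
          TangentBundle (𝓡∂ 4) ↥(handleTube 3 2))).2) =ᶠ[𝓝 u₀]
      fun u : 𝕊 1 => fderiv ℝ (closedBallAmbChart ((coreTubePt u₀ : ↥(handleTube 3 2)) : 𝔻⁴))
        (corePt u) (EuclideanSpace.single (2 : Fin 4) (1 : ℝ)) := by
  -- points `u` whose circle point lies in the source of the ambient chart at the base point
  have hsrc : ∀ᶠ u : 𝕊 1 in 𝓝 u₀, corePt u ∈
      (closedBallAmbChart ((coreTubePt u₀ : ↥(handleTube 3 2)) : 𝔻⁴)).source := by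
    have hc : Continuous fun u : 𝕊 1 => corePt u := continuous_corePt
    exact hc.continuousAt.preimage_mem_nhds
      ((closedBallAmbChart _).open_source.mem_nhds (coe_mem_closedBallAmbChart_source _))
  filter_upwards [hsrc] with u hu
  rw [TangentBundle.trivializationAt_apply]
  dsimp only
  -- replace the transition map of the charts of `T` by that of `D⁴`
  have heq := extend_comp_symm_eventuallyEq_tube (coreTubePt u₀) (coreTubePt u)
  rw [Filter.EventuallyEq.fderivWithin_eq (heq.filter_mono nhdsWithin_le_nhds) heq.self_of_nhds]
  -- the `D⁴` computation of `ClosedBallTangent.lean` (its base point is the same point)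
  have hD : fderivWithin ℝ
      ((chartAt (EuclideanHalfSpace 4) ((coreTubePt u₀ : ↥(handleTube 3 2)) : 𝔻⁴)).extend (𝓡∂ 4) ∘
        ((chartAt (EuclideanHalfSpace 4) ((coreTubePt u : ↥(handleTube 3 2)) : 𝔻⁴)).extend (𝓡∂ 4)).symm)
      (range (𝓡∂ 4))
      ((chartAt (EuclideanHalfSpace 4) (coreTubePt u)).extend (𝓡∂ 4) (coreTubePt u))
      (tubeFramingField (coreTubePt u)) =
      fderiv ℝ (closedBallAmbChart ((coreTubePt u₀ : ↥(handleTube 3 2)) : 𝔻⁴))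
        (((coreTubePt u : ↥(handleTube 3 2)) : 𝔻⁴) : E4)
        (closedBallCoeDeriv ((coreTubePt u : ↥(handleTube 3 2)) : 𝔻⁴) (tubeFramingField (coreTubePt u))) :=
    trivializationAt_tangentSpace_closedBall_snd
      (x₀ := ((coreTubePt u₀ : ↥(handleTube 3 2)) : 𝔻⁴))
      (x := ((coreTubePt u : ↥(handleTube 3 2)) : 𝔻⁴)) hu (tubeFramingField (coreTubePt u))
  rw [hD]
  unfold tubeFramingField
  rw [ContinuousLinearEquiv.apply_symm_apply, coe_coe_coreTubePt]

/-- The ambient expression `u ↦ D(ambChart (θ₀,0))(θ, 0)` is continuous at `u₀` (indeed `C^∞`: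
`contMDiffAt_fderiv_closedBallAmbChart` composed with the model circle). [folklore] -/
theorem continuousAt_fderiv_closedBallAmbChart_corePt (u₀ : 𝕊 1) :
    ContinuousAt (fun u : 𝕊 1 =>
      fderiv ℝ (closedBallAmbChart ((coreTubePt u₀ : ↥(handleTube 3 2)) : 𝔻⁴)) (corePt u)) u₀ := by
  have hF : ContMDiffAt (𝓡 1) 𝓘(ℝ, E4 →L[ℝ] E4) ∞
      ((fun x : 𝔻⁴ => fderiv ℝ (closedBallAmbChart ((coreTubePt u₀ : ↥(handleTube 3 2)) : 𝔻⁴)) (x : E4)) ∘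
        fun u : 𝕊 1 => ((coreTubePt u : ↥(handleTube 3 2)) : 𝔻⁴)) u₀ :=
    (contMDiffAt_fderiv_closedBallAmbChart ((coreTubePt u₀ : ↥(handleTube 3 2)) : 𝔻⁴)).comp u₀
      (contMDiff_coe_coreTubePt u₀)
  exact hF.continuousAt

/-- **The framing direction field along the model circle is a continuous map into `TT`.**
[folklore] -/
theorem continuous_coreSection :
    Continuous fun u : 𝕊 1 => (Bundle.TotalSpace.mk' E4 (coreTubePt u)
      (tubeFramingField (coreTubePt u)) : TangentBundle (𝓡∂ 4) ↥(handleTube 3 2)) := by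
  refine continuous_iff_continuousAt.2 fun u₀ => ?_
  rw [FiberBundle.continuousAt_totalSpace]
  refine ⟨continuous_coreTubePt.continuousAt, ?_⟩
  -- the fibre coordinate is eventually the ambient expression, which is continuous
  have hc : ContinuousAt (fun u : 𝕊 1 =>
      fderiv ℝ (closedBallAmbChart ((coreTubePt u₀ : ↥(handleTube 3 2)) : 𝔻⁴))
        (corePt u) (EuclideanSpace.single (2 : Fin 4) (1 : ℝ))) u₀ :=
    ((ContinuousLinearMap.apply ℝ E4 (EuclideanSpace.single (2 : Fin 4) (1 : ℝ))).continuous.continuousAt).comp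
      (continuousAt_fderiv_closedBallAmbChart_corePt u₀)
  exact hc.congr (trivializationAt_coreSection_snd_eventuallyEq u₀).symm

/-! ### Assembly -/

/-- **The handle framing of a 2-handle attaching map is a framing of its attaching circle in
`∂W`** (`IsKnotFraming`: continuous into `TW`, tangent to `∂W`, nowhere tangent to the
attaching circle) — for every attaching map `h̄ : T → W` on every 4-manifold with boundary.
[folklore] -/
theorem isKnotFraming_attachingFraming (h : HandleAttachingMap 3 2 W) :
    IsKnotFraming h.attachingCircle h.attachingFraming where
  continuous := by
    have h1 := h.isSmoothEmbedding.contMDiff.continuous_tangentMap (WithTop.coe_le_coe.2 le_top)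
    have heq : (fun u : 𝕊 1 => (Bundle.TotalSpace.mk' E4 (h.attachingCircle u) (h.attachingFraming u) :
        TangentBundle (𝓡∂ 4) W)) =
        tangentMap (𝓡∂ 4) (𝓡∂ 4) h.toFun ∘ fun u : 𝕊 1 => (Bundle.TotalSpace.mk' E4 (coreTubePt u)
          (tubeFramingField (coreTubePt u)) : TangentBundle (𝓡∂ 4) ↥(handleTube 3 2)) := rfl
    rw [heq]
    exact h1.comp continuous_coreSection
  mem_boundaryTangentSpace u := by
    rw [mem_boundaryTangentSpace_iff]; exact attachingFraming_apply_zero h u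
  not_mem_span t := attachingFraming_not_mem_span h t

end Literature.Geometry.Symplectic

end
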